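import Literature.NumberTheory.GaloisRepresentations.TateDualHomUnits
import Literature.NumberTheory.GaloisRepresentations.HomDualReadoutNaturality
import Literature.NumberTheory.GaloisRepresentations.HomDualValuationSplitting
import HarnessLib

/-!
# The `(R2)` compatibility of the presentation-road readout: `loc_v (δ₀_K h) = δ₀_{K_v} (ι_v ∘ h)`

Topic `NumberTheory/GaloisRepresentations`; namespace `Literature.NumberTheory.GaloisRepresentations.HomDual`.
Definitions with bodies and theorems; no named fact, no instance, no `sorry`.  Sequel to `HomDualPresentation`,
`HomDualRestrictField`, `HomDualReadoutNaturality`, `TateDualHomUnits` (door-c6 g16 presentation road).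

* §1 `resAlongHom θ f`: a `Γ`-morphism `f : M → M'` as a `θ`-equivariant morphism `M|_θ → M'|_θ` (plumbing for
  `ContinuousCohomology.map θ`), and `res ∘ H(f) = H(θ, f|)`.
* §2 `unitsTransfer K K' : K̄ˣ|_{Γ_{K'}} → K̄'ˣ`, `u ↦ ι u` along the chosen `ι : K̄ → K̄'`, a morphism of discrete
  `Γ_{K'}`-modules; `ι ∘ (μₙ ↪ K̄ˣ) = (μₙ ↪ K̄'ˣ) ∘ muTransfer`.
* §3 the global identification `tateDualUnitsIso K ρ n : ρ^∨(1) = Hom(M, μₙ(K̄)) ≅ Hom_ℤ(M, K̄ˣ)` (`n • M = 0`).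
* §4 **`(R2)`**: for a number field `K`, a finite place `v`, a presentation `0 → X → Y → M → 0` of the finite
  `n`-torsion module `M` (`ρ`) and an equivariant `h : X → K̄ˣ`,

    `loc_v ((tateDualUnitsIso)⁻¹ (dualδ₀_K h)) = (tateDualLocalUnitsIso_v)⁻¹ (dualδ₀_{K_v} (ι_v ∘ h))`

  in `H¹(K_v, ρ^∨(1))` (`localization_dualδ₀_eq`): the class read off over `K_v` from the transferred map
  `ι_v ∘ h : X|_v → K̄_vˣ` is the localisation of the global class of `h`.

References: Milne, *Arithmetic Duality Theorems* I §0, I §2, I §4; Neukirch–Schmidt–Wingberg (1.5.2).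
-/

noncomputable section

namespace Literature.NumberTheory.GaloisRepresentations

open Function ContRepresentation

universe u

/-! ## §1 A `Γ`-morphism as a `θ`-equivariant morphism of restricted modules -/

section ResAlong

variable {Γ Γ' : Type u} [Group Γ] [TopologicalSpace Γ] [IsTopologicalGroup Γ]
  [Group Γ'] [TopologicalSpace Γ'] [IsTopologicalGroup Γ']
variable {M M' : Type u} [AddCommGroup M] [TopologicalSpace M] [DiscreteTopology M]
  [AddCommGroup M'] [TopologicalSpace M'] [DiscreteTopology M']
variable {ρ : ContinuousRep Γ ℤ M} {ρ' : ContinuousRep Γ ℤ M'}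

/-- A `Γ`-morphism `f : M → M'` viewed as a `θ`-equivariant morphism `M|_θ → (M'.restrict θ)` out of Mathlib's
`TopRep.res θ M` (the shape `ContinuousCohomology.map θ` consumes). [cite: NeukirchSchmidtWingberg2008, (1.5.2)] -/
def resAlongHom (θ : Γ' →ₜ* Γ) (f : ρ.toTopRep ⟶ ρ'.toTopRep) :
    TopRep.res (θ : Γ' →* Γ) ρ.toTopRep ⟶ (ρ'.restrict θ).toTopRep :=
  TopRep.ofHom ⟨f.hom.toContinuousLinearMap, fun σ => f.hom.isIntertwining' (θ σ)⟩

omit [IsTopologicalGroup Γ] [IsTopologicalGroup Γ'] in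
/-- `resAlongHom θ f` is `f` on elements. [cite: NeukirchSchmidtWingberg2008, (1.5.2)] -/
@[simp] theorem resAlongHom_hom_apply (θ : Γ' →ₜ* Γ) (f : ρ.toTopRep ⟶ ρ'.toTopRep) (x : M) :
    (resAlongHom θ f).hom x = f.hom x := rfl

/-- **`res_θ ∘ Hⁿ(f) = Hⁿ(θ, f|)`**: restriction along `θ` after the coefficient map `f` is the single
change-of-group map along `resAlongHom θ f`. [cite: NeukirchSchmidtWingberg2008, (1.5.2)] -/
theorem map_resAlongHom_eq (θ : Γ' →ₜ* Γ) (f : ρ.toTopRep ⟶ ρ'.toTopRep) (q : ℕ)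
    (x : continuousCohomology q ρ.toTopRep) :
    ContinuousCohomology.map θ (resAlongHom θ f) q x =
      ContinuousCohomology.map θ (X := ρ'.toTopRep) (Y := (ρ'.restrict θ).toTopRep)
        (TopRep.ofHom ⟨ContinuousLinearMap.id ℤ M', fun _ => rfl⟩) q (cohomologyMap f q x) :=
  map_comp_apply_of (ContinuousMonoidHom.id Γ) θ θ (fun _ => rfl) (resIdHom f) _ _ (fun _ => rfl) q x

end ResAlong

namespace HomDual

open Literature.Algebra.Homology Literature.Algebra.Homology.DiscreteRep Field DiscreteGaloisModule

/-! ## §2 The units transfer `K̄ˣ|_{Γ_{K'}} → K̄'ˣ` -/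

section Transfer

variable (K : Type) [Field K] (K' : Type) [Field K'] [Algebra K K']

/-- **`u ↦ ι u : K̄ˣ → K̄'ˣ`** on carriers, along the chosen embedding `ι : K̄ → K̄'`. [cite: MilneADT2006, I §0, I §4] -/
def unitsTransferAddHom : UnitsCarrier K →+ UnitsCarrier K' where
  toFun u := UnitsCarrier.ofUnits
    (Units.map (absClosureEmbedding K K' : AlgebraicClosure K →* AlgebraicClosure K') (unitsVal K u))
  map_zero' := unitsVal_injective K' (by
    rw [unitsVal_ofUnits]
    change Units.map _ 1 = 1
    rw [map_one])
  map_add' u u' := unitsVal_injective K' (by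
    rw [unitsVal_ofUnits, unitsVal_add, unitsVal_add, unitsVal_ofUnits, unitsVal_ofUnits, map_mul])

/-- `unitsVal (unitsTransfer u) = ι (unitsVal u)`. [cite: MilneADT2006, I §0] -/
@[simp] theorem unitsVal_unitsTransferAddHom (u : UnitsCarrier K) :
    unitsVal K' (unitsTransferAddHom K K' u) =
      Units.map (absClosureEmbedding K K' : AlgebraicClosure K →* AlgebraicClosure K') (unitsVal K u) := rfl

/-- **`ι` is `res`-equivariant on units**: `ι ((res σ) u) = σ (ι u)`. [cite: MilneADT2006, I §0, I §4] -/
theorem unitsTransferAddHom_smul (σ : absoluteGaloisGroup K') (u : UnitsCarrier K) :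
    unitsTransferAddHom K K' (units K (absGaloisRestrict K K' σ) u) = units K' σ (unitsTransferAddHom K K' u) := by
  apply unitsVal_injective K'
  apply Units.ext
  simp only [unitsVal_unitsTransferAddHom, unitsVal_apply, Units.coe_map, MonoidHom.coe_coe, Units.coe_smul,
    absGaloisRestrict_apply_smul]

/-- **`K̄ˣ|_{Γ_{K'}} → K̄'ˣ` as a morphism of discrete `Γ_{K'}`-modules.** [cite: MilneADT2006, I §0, I §4] -/
def unitsTransfer : ((units K).restrictField K').toContRepresentation →ⁱL (units K').toContRepresentation where
  toLinearMap := (unitsTransferAddHom K K').toIntLinearMap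
  cont := continuous_of_discreteTopology
  isIntertwining' σ := by
    refine ContinuousLinearMap.ext fun u => ?_
    simpa [ContinuousRep.toContRepresentation_apply_apply, GaloisRep.restrictField_apply] using
      unitsTransferAddHom_smul K K' σ u

/-- Unfolding `unitsTransfer`. [cite: MilneADT2006, I §0] -/
@[simp] theorem unitsTransfer_apply (u : UnitsCarrier K) : unitsTransfer K K' u = unitsTransferAddHom K K' u := rfl

/-- **`ι ∘ (μₙ ↪ K̄ˣ) = (μₙ ↪ K̄'ˣ) ∘ muTransfer`.** [cite: MilneADT2006, I §0] -/
theorem unitsTransferAddHom_kummerInclAddHom (n : ℕ) (ζ : MuCarrier K n) :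
    unitsTransferAddHom K K' (kummerInclAddHom K n ζ) = kummerInclAddHom K' n (muTransfer K K' n ζ) :=
  unitsVal_injective K' (by
    rw [unitsVal_unitsTransferAddHom, unitsVal_kummerInclAddHom, unitsVal_kummerInclAddHom, muVal_muTransfer])

end Transfer

/-! ## §3 The global identification `ρ^∨(1) ≅ Hom_ℤ(M, K̄ˣ)` -/

section Global

variable (K : Type) [Field K] {M : Type} [AddCommGroup M] [TopologicalSpace M] [DiscreteTopology M] [Finite M]
  (ρ : DiscreteGaloisModule K M) (n : ℕ)

/-- Equivariance of `f ↦ ι ∘ f : ρ^∨(1) → Hom_ℤ(M, K̄ˣ)` for the tree's `tateDual`. [cite: MilneADT2006, I §0, I §2] -/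
theorem homMuUnits_tateDual_smul (σ : absoluteGaloisGroup K) (f : TateDual K M n) :
    homMuUnits K n (M := M) (ρ.tateDual n σ f) = homGaloisModule ρ (units K) σ (homMuUnits K n (M := M) f) := by
  refine LinearMap.ext fun m => unitsVal_injective K ?_
  change unitsVal K (kummerInclAddHom K n (mu K n σ (f (ρ σ⁻¹ m)))) =
    unitsVal K (units K σ (kummerInclAddHom K n (f (ρ σ⁻¹ m))))
  rw [unitsVal_kummerInclAddHom, muVal_apply, unitsVal_apply, unitsVal_kummerInclAddHom]

/-- **`ρ^∨(1) = Hom(M, μₙ(K̄)) ≅ Hom_ℤ(M, K̄ˣ)` in `TopRep`** for `n`-torsion `M` (the tree's `ρ.tateDual n`).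
[cite: MilneADT2006, I §0, I §2] -/
def tateDualUnitsIso (hM : ∀ m : M, n • m = 0) :
    (ρ.tateDual n).toTopRep ≅ (homGaloisModule ρ (units K)).toTopRep :=
  topRepIsoOfEquiv (X := (ρ.tateDual n).toTopRep) (Y := (homGaloisModule ρ (units K)).toTopRep)
    { (AddEquiv.ofBijective (homMuUnits K n (M := M)) (homMuUnits_bijective K n hM)).toIntLinearEquiv with
      continuous_toFun := continuous_of_discreteTopology
      continuous_invFun := continuous_of_discreteTopology }
    fun σ f => homMuUnits_tateDual_smul K ρ n σ f

/-- Unfolding `tateDualUnitsIso` on elements: `f ↦ (m ↦ ι (f m))`. [cite: MilneADT2006, I §0, I §2] -/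
@[simp] theorem tateDualUnitsIso_hom_apply (hM : ∀ m : M, n • m = 0) (f : TateDual K M n) (m : M) :
    (show M →ₗ[ℤ] UnitsCarrier K from (tateDualUnitsIso K ρ n hM).hom.hom f) m = kummerInclAddHom K n (f m) := rfl

/-- `Hⁱ(K, ρ^∨(1)) → Hⁱ(K, Hom_ℤ(M, K̄ˣ))` is bijective. [cite: MilneADT2006, I §0, I §2] -/
theorem cohomologyMap_tateDualUnitsIso_bijective (hM : ∀ m : M, n • m = 0) (q : ℕ) :
    Bijective (cohomologyMap (tateDualUnitsIso K ρ n hM).hom q) :=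
  (continuousCohomologyEquivOfIso (tateDualUnitsIso K ρ n hM) q).bijective

/-- `Hⁱ(e.hom) (Hⁱ(e.inv) y) = y` for `e = tateDualUnitsIso`. [cite: MilneADT2006, I §0, I §2] -/
theorem cohomologyMap_tateDualUnitsIso_hom_inv_apply (hM : ∀ m : M, n • m = 0) (q : ℕ)
    (y : continuousCohomology q (homGaloisModule ρ (units K)).toTopRep) :
    cohomologyMap (tateDualUnitsIso K ρ n hM).hom q (cohomologyMap (tateDualUnitsIso K ρ n hM).inv q y) = y :=
  cohomologyMap_inv_hom_apply (tateDualUnitsIso K ρ n hM).symm q y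

end Global

/-! ## §4 `(R2)`: localisation of the global class of `h` is the local class of `ι_v ∘ h` -/

section Local

open IsDedekindDomain NumberField

variable {K : Type} [Field K] [NumberField K] (v : HeightOneSpectrum (𝓞 K))
variable {X Y M : Type}
  [AddCommGroup X] [TopologicalSpace X] [DiscreteTopology X] [Module.Finite ℤ X]
  [AddCommGroup Y] [TopologicalSpace Y] [DiscreteTopology Y] [Module.Finite ℤ Y]
  [AddCommGroup M] [TopologicalSpace M] [DiscreteTopology M] [Finite M]
variable (ρX : DiscreteGaloisModule K X) (ρY : DiscreteGaloisModule K Y) (ρ : DiscreteGaloisModule K M)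
  (i : ρX.toContRepresentation →ⁱL ρY.toContRepresentation)
  (p : ρY.toContRepresentation →ⁱL ρ.toContRepresentation)

/-- **Module-level compatibility of the two identifications**: over `K_v`, post-composition with `ι_v`
(`Hom_ℤ(M, K̄ˣ) → Hom_ℤ(M|_v, K̄_vˣ)`) corresponds, under `tateDualUnitsIso` (global) and
`tateDualLocalUnitsIso` (local), to the identity of `ρ^∨(1)`:  `ι_v ∘ (ι ∘ f) = ι_{K_v} ∘ (muTransfer ∘ f)`.
[cite: MilneADT2006, I §0, I §2] -/
theorem postcompAddHom_unitsTransfer_eq (n : ℕ) [NeZero n] (hM : ∀ m : M, n • m = 0)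
    (F : DiscreteRep.HomCarrier M (UnitsCarrier K)) :
    postcompAddHom (units K) (units (v.adicCompletion K)) (unitsTransfer K (v.adicCompletion K)) F =
      (tateDualLocalUnitsIso v ρ n hM).hom.hom ((tateDualUnitsIso K ρ n hM).inv.hom F) := by
  set f := (tateDualUnitsIso K ρ n hM).inv.hom F with hf
  have hF : F = (tateDualUnitsIso K ρ n hM).hom.hom f := by
    rw [hf, ← TopRep.comp_apply, (tateDualUnitsIso K ρ n hM).inv_hom_id, TopRep.id_apply]
  rw [hF]
  refine LinearMap.ext fun m => unitsVal_injective (v.adicCompletion K) ?_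
  rw [unitsVal_tateDualLocalUnitsIso_hom_apply]
  change unitsVal (v.adicCompletion K) (unitsTransferAddHom K (v.adicCompletion K)
    ((show M →ₗ[ℤ] UnitsCarrier K from (tateDualUnitsIso K ρ n hM).hom.hom f) m)) = _
  rw [unitsVal_unitsTransferAddHom, tateDualUnitsIso_hom_apply, unitsVal_kummerInclAddHom]

/-- **`(R2)` of the presentation road.**  For a presentation `0 → X → Y → M → 0` of a finite `n`-torsion
Galois module `M` over a number field `K`, an equivariant `h : X → K̄ˣ` and a finite place `v`:
the localisation at `v` of the global class `(tateDualUnitsIso)⁻¹ (δ₀_K h) ∈ H¹(K, ρ^∨(1))` is the class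
`(tateDualLocalUnitsIso_v)⁻¹ (δ₀_{K_v} (ι_v ∘ h)) ∈ H¹(K_v, ρ^∨(1))` read off over `K_v` from the transferred map
`ι_v ∘ h : X|_v → K̄_vˣ` and the restricted presentation. [cite: MilneADT2006, I §0, I §2, I §4]
[cite: NeukirchSchmidtWingberg2008, (1.3.3), (1.5.2)] -/
theorem localization_dualδ₀_eq (n : ℕ) [NeZero n] (hM : ∀ m : M, n • m = 0)
    (hS : IsSES (toTopRepHom ρX ρY i) (toTopRepHom ρY ρ p))
    (h : (homGaloisModule ρX (units K)).toTopRep.ρ.invariants) :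
    galoisCohomology.localization (ρ.tateDual n) (Sum.inr v) 1
        (cohomologyMap (tateDualUnitsIso K ρ n hM).inv 1
          (dualδ₀ ρX ρY ρ (units K) i p hS (baer_unitsCarrier K) h)) =
      cohomologyMap (tateDualLocalUnitsIso v ρ n hM).inv 1
        (dualδ₀ (ρX.restrictField (v.adicCompletion K)) (ρY.restrictField (v.adicCompletion K))
          (ρ.restrictField (v.adicCompletion K)) (units (v.adicCompletion K))
          (restrictIntertwining ρX ρY i) (restrictIntertwining ρY ρ p) (isSES_restrict ρX ρY ρ hS)
          (baer_unitsCarrier (v.adicCompletion K))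
          (transferInvariant ρX (units K) (units (v.adicCompletion K)) (unitsTransfer K (v.adicCompletion K)) h)) := by
  apply (cohomologyMap_tateDualLocalUnitsIso_bijective v ρ n hM 1).1
  rw [cohomologyMap_tateDualLocalUnitsIso_hom_inv_apply,
    ← map_dualδ₀_eq ρX ρY ρ (units K) (units (v.adicCompletion K)) (unitsTransfer K (v.adicCompletion K)) i p hS
      (baer_unitsCarrier K) (baer_unitsCarrier (v.adicCompletion K)) h]
  set δ := dualδ₀ ρX ρY ρ (units K) i p hS (baer_unitsCarrier K) h
  let θ : absoluteGaloisGroup (v.adicCompletion K) →ₜ* absoluteGaloisGroup K := absGaloisRestrict K (v.adicCompletion K)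
  -- `loc_v ∘ H¹(e⁻¹) = H¹(θ, e⁻¹|)`
  have h1 : galoisCohomology.localization (ρ.tateDual n) (Sum.inr v) 1
      (cohomologyMap (tateDualUnitsIso K ρ n hM).inv 1 δ) =
      ContinuousCohomology.map θ (resAlongHom θ (tateDualUnitsIso K ρ n hM).inv) 1 δ :=
    (map_resAlongHom_eq θ (tateDualUnitsIso K ρ n hM).inv 1 δ).symm
  rw [h1]
  -- `H¹(e_v) ∘ H¹(θ, e⁻¹|) = H¹(θ, ι_v ∘ –)`
  exact (map_comp_apply_of θ (ContinuousMonoidHom.id _) θ (fun _ => rfl)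
    (resAlongHom θ (tateDualUnitsIso K ρ n hM).inv) (resIdHom (tateDualLocalUnitsIso v ρ n hM).hom)
    (postcompResHom ρ (units K) (units (v.adicCompletion K)) (unitsTransfer K (v.adicCompletion K)))
    (fun F => postcompAddHom_unitsTransfer_eq v ρ n hM F) 1 δ).symm

end Local

end HomDual

end Literature.NumberTheory.GaloisRepresentations

end
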